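import Summits.CriticalPhenomena.PercolationContinuityZ3.Theorems.PercNearOneGluingNoHeavyLowerTailSahiGridPatternYProfile

/-!
# `NoHeavyLowerTail` (crux stmt-CriticalPhenomena-4575), Sahi programme P1: SYMMETRY of the pattern functional and its PROVED FACES
# in every dimension

Support file (Sahi cell, seat `prim-sahi-p1`, generation 8; `--supports stmt-CriticalPhenomena-4575`).  Pure proofs, no definitions, no
`sorry`, standard axioms.

THE MATHEMATICS.  The pattern tensor `t_d` (`tcD`) is a symmetric function of its three arguments (`tcD_swap12`, `tcD_swap23`), hence so
is the pattern functional: `sStarD_swap12`, `sStarD_swap23` (every `d`).  Combining with the generation-8 faces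
`sStarD_univ_nonneg` (z-profile theorem, `…ZDecomp`) and `sStarD_nonneg_of_subset_inter` (C-slot profile, `…YProfile`) gives, in EVERY
dimension and for up-sets `A, B, C` of `[3]^d`, `sStarD A B C ≥ 0` as soon as
* one of the three sets is the whole cube (`sStarD_nonneg_of_eq_univ₁/₂`, `sStarD_univ_nonneg`), or
* one of the three sets is contained in the intersection of the other two (`sStarD_nonneg_of_subset₁/₂`, `sStarD_nonneg_of_subset_inter`; this includes all NESTED triples, `sStarD_nonneg_of_nested`).
These are the boundary strata of `PatternPos d`; its interior (three up-sets in general position) is open for `d ≥ 4` (certificate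
campaign for `d = 4` in progress, generation-8 memo).  Nothing conjectural is asserted. [this work]
-/

namespace Summit.CriticalPhenomena.PercolationContinuityZ3.Theorems.SahiGridPattern

open Finset SahiGrid3
open scoped BigOperators

variable {d : ℕ}

/-! ### Symmetry of the per-axis counts and of the tensor -/

/-- `c1` is symmetric in its first two arguments. [this work] -/
theorem c1_swap12 : ∀ u v w : Fin 3, c1 u v w = c1 v u w := by decide
/-- `c1` is symmetric in its last two arguments. [this work] -/
theorem c1_swap23 : ∀ u v w : Fin 3, c1 u v w = c1 u w v := by decide
/-- `c2 u v w = [u ≠ v = w]` is symmetric in its last two arguments. [this work] -/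
theorem c2_swap23 : ∀ u v w : Fin 3, c2 u v w = c2 u w v := by decide
/-- `c3` is symmetric in its first two arguments. [this work] -/
theorem c3_swap12 : ∀ u v w : Fin 3, c3 u v w = c3 v u w := by decide
/-- `c3` is symmetric in its last two arguments. [this work] -/
theorem c3_swap23 : ∀ u v w : Fin 3, c3 u v w = c3 u w v := by decide

/-- **The pattern tensor is symmetric in its first two arguments.** [this work] -/
theorem tcD_swap12 (p q r : Pd d) : tcD p q r = tcD q p r := by
  unfold tcD
  have h1 : (∏ a, c1 (p a) (q a) (r a)) = ∏ a, c1 (q a) (p a) (r a) := Finset.prod_congr rfl fun a _ => c1_swap12 _ _ _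
  have h4 : (∏ a, c2 (r a) (p a) (q a)) = ∏ a, c2 (r a) (q a) (p a) := Finset.prod_congr rfl fun a _ => c2_swap23 _ _ _
  have h5 : (∏ a, c3 (p a) (q a) (r a)) = ∏ a, c3 (q a) (p a) (r a) := Finset.prod_congr rfl fun a _ => c3_swap12 _ _ _
  rw [h1, h4, h5]
  ring

/-- **The pattern tensor is symmetric in its last two arguments.** [this work] -/
theorem tcD_swap23 (p q r : Pd d) : tcD p q r = tcD p r q := by
  unfold tcD
  have h1 : (∏ a, c1 (p a) (q a) (r a)) = ∏ a, c1 (p a) (r a) (q a) := Finset.prod_congr rfl fun a _ => c1_swap23 _ _ _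
  have h2 : (∏ a, c2 (p a) (q a) (r a)) = ∏ a, c2 (p a) (r a) (q a) := Finset.prod_congr rfl fun a _ => c2_swap23 _ _ _
  have h5 : (∏ a, c3 (p a) (q a) (r a)) = ∏ a, c3 (p a) (r a) (q a) := Finset.prod_congr rfl fun a _ => c3_swap23 _ _ _
  rw [h1, h2, h5]
  ring

/-- **`sStarD` is symmetric in its first two arguments** (every dimension). [this work] -/
theorem sStarD_swap12 (A B C : Finset (Pd d)) : sStarD A B C = sStarD B A C := by
  rw [sStarD_eq_sum_tcD, sStarD_eq_sum_tcD, Finset.sum_comm]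
  exact Finset.sum_congr rfl fun q _ => Finset.sum_congr rfl fun p _ => Finset.sum_congr rfl fun r _ => tcD_swap12 p q r

/-- **`sStarD` is symmetric in its last two arguments** (every dimension). [this work] -/
theorem sStarD_swap23 (A B C : Finset (Pd d)) : sStarD A B C = sStarD A C B := by
  rw [sStarD_eq_sum_tcD, sStarD_eq_sum_tcD]
  refine Finset.sum_congr rfl fun p _ => ?_
  rw [Finset.sum_comm]
  exact Finset.sum_congr rfl fun r _ => Finset.sum_congr rfl fun q _ => tcD_swap23 p q r

/-! ### Faces: one set is the whole cube -/

-- (third set the whole cube: `sStarD_univ_nonneg` in `…ZDecomp`)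

/-- `PatternPos` face, every dimension: second set the whole cube. [this work] -/
theorem sStarD_nonneg_of_eq_univ₂ {A C : Finset (Pd d)} (hA : IsUpperSet (A : Set (Pd d))) (hC : IsUpperSet (C : Set (Pd d))) :
    0 ≤ sStarD A univ C := by
  rw [sStarD_swap23]; exact sStarD_univ_nonneg hA hC

/-- `PatternPos` face, every dimension: first set the whole cube. [this work] -/
theorem sStarD_nonneg_of_eq_univ₁ {B C : Finset (Pd d)} (hB : IsUpperSet (B : Set (Pd d))) (hC : IsUpperSet (C : Set (Pd d))) :
    0 ≤ sStarD univ B C := by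
  rw [sStarD_swap12, sStarD_swap23]; exact sStarD_univ_nonneg hB hC

/-! ### Faces: one set below the other two -/

-- (`C ⊆ A ∩ B`: `sStarD_nonneg_of_subset_inter` in `…YProfile`)

/-- `PatternPos` face, every dimension: `B ⊆ A ∩ C`. [this work] -/
theorem sStarD_nonneg_of_subset₂ {A B C : Finset (Pd d)} (h : B ⊆ A ∩ C) : 0 ≤ sStarD A B C := by
  rw [sStarD_swap23]; exact sStarD_nonneg_of_subset_inter h

/-- `PatternPos` face, every dimension: `A ⊆ B ∩ C`. [this work] -/
theorem sStarD_nonneg_of_subset₁ {A B C : Finset (Pd d)} (h : A ⊆ B ∩ C) : 0 ≤ sStarD A B C := by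
  rw [sStarD_swap12, sStarD_swap23]
  exact sStarD_nonneg_of_subset_inter h

/-- In particular every NESTED triple `A ⊆ B ⊆ C` of subsets of `[3]^d` has `sStarD A B C ≥ 0`, in every dimension. [this work] -/
theorem sStarD_nonneg_of_nested {A B C : Finset (Pd d)} (hAB : A ⊆ B) (hBC : B ⊆ C) : 0 ≤ sStarD A B C :=
  sStarD_nonneg_of_subset₁ (Finset.subset_inter hAB (hAB.trans hBC))

end Summit.CriticalPhenomena.PercolationContinuityZ3.Theorems.SahiGridPattern
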